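import Mathlib
import Literature.Combinatorics.Additive.TripleProductProperty
import Summits.MatrixMultiplication.MatrixMultiplication.Theorems.SnSubsetDichotomyPolynomialSlackStubSplit
import Summits.MatrixMultiplication.MatrixMultiplication.Theorems.SnSubsetDichotomyPolynomialSlackExcessCap

/-!
# Pair marginals of quotient sets and the six-fold fixed-point count

Helper file for the LEVEL-ONE programme on the crux `SnSubsetDichotomy.PolynomialSlack`
(stmt-MatrixMultiplication-8306). For `X, Y ⊆ S_n` the PAIR MARGINAL
`m_{XY}(i,j) = #{(x,y) ∈ X × Y : y j = x i}` counts the pairs whose quotient `x⁻¹y` maps `j ↦ i`; it is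
an `n × n` array with all row and column sums `|X||Y|` (`sum_pairMarginal_fst/snd`). Results:

* `sixFoldFix_eq_tripleSum` — the six-fold fixed-point count of `…LevelOnePinning` is the cyclic
  triple sum of pair marginals: `T₃ = Σ_{p,q,w} m_{ST}(p,w)·m_{TU}(w,q)·m_{US}(q,p)` (pure counting:
  `s⁻¹t·t'⁻¹u·u'⁻¹s'` fixes `p` iff `u'⁻¹s' p = q`, `t'⁻¹u q = w`, `s⁻¹t w = p` for some `q, w`);
* `pairMarginal_eq_marginal_image₂`, `card_image₂_of_injOn'` — when `(x,y) ↦ x⁻¹y` is injective on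
  `X × Y` (e.g. two sets of a TPP triple, `injOn_quot_first`), `m_{XY}` is the marginal
  `M_A(i,j) = #{a ∈ A : a j = i}` of the quotient SET `A = X⁻¹Y` and `|A| = |X||Y|`;
* `excess_cap_pair` — hence the excess cap of `…ExcessCap` for pair marginals of such pairs:
  `(n-1)·Σ m_{XY}² ≤ |X||Y|·(n! + (n-2)|X||Y|)`.
-/

namespace Summit.MatrixMultiplication.MatrixMultiplication.Theorems.PolynomialSlack

open scoped BigOperators
open Literature.Combinatorics.Additive (TripleProductProperty)

-- `Summit.<Summit>.<Problem>` is the tree's mandated summit-side namespace (CONVENTIONS §2); for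
-- this single-conjunct summit the two coincide, so each declaration silences `dupNamespace`.
set_option linter.dupNamespace false

variable {n : ℕ}

/-! ## Row and column sums -/

/-- Column sums of the pair marginal: `Σ_i m_{XY}(i,j) = |X||Y|` (each pair maps `j` to exactly one
`i = x⁻¹(y j)`). [folklore] -/
theorem sum_pairMarginal_fst (X Y : Finset (Equiv.Perm (Fin n))) (j : Fin n) :
    ∑ i : Fin n, ((X ×ˢ Y).filter fun xy => xy.2 j = xy.1 i).card = X.card * Y.card := by
  classical
  rw [← Finset.card_product]
  rw [Finset.card_eq_sum_card_fiberwise (f := fun xy : Equiv.Perm (Fin n) × Equiv.Perm (Fin n) =>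
    xy.1⁻¹ (xy.2 j)) (t := Finset.univ) (fun _ _ => Finset.mem_univ _)]
  refine Finset.sum_congr rfl fun i _ => ?_
  congr 1
  ext ⟨x, y⟩
  simp only [Finset.mem_filter, Equiv.Perm.inv_eq_iff_eq]

/-- Row sums of the pair marginal: `Σ_j m_{XY}(i,j) = |X||Y|`. [folklore] -/
theorem sum_pairMarginal_snd (X Y : Finset (Equiv.Perm (Fin n))) (i : Fin n) :
    ∑ j : Fin n, ((X ×ˢ Y).filter fun xy => xy.2 j = xy.1 i).card = X.card * Y.card := by
  classical
  rw [← Finset.card_product]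
  rw [Finset.card_eq_sum_card_fiberwise (f := fun xy : Equiv.Perm (Fin n) × Equiv.Perm (Fin n) =>
    xy.2⁻¹ (xy.1 i)) (t := Finset.univ) (fun _ _ => Finset.mem_univ _)]
  refine Finset.sum_congr rfl fun j _ => ?_
  congr 1
  ext ⟨x, y⟩
  simp only [Finset.mem_filter, Equiv.Perm.inv_eq_iff_eq]
  constructor
  · rintro ⟨h1, h2⟩; exact ⟨h1, h2.symm⟩
  · rintro ⟨h1, h2⟩; exact ⟨h1, h2.symm⟩

/-- Pair marginals are at most `|X||Y|`. [folklore] -/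
theorem pairMarginal_le (X Y : Finset (Equiv.Perm (Fin n))) (i j : Fin n) :
    ((X ×ˢ Y).filter fun xy => xy.2 j = xy.1 i).card ≤ X.card * Y.card := by
  rw [← Finset.card_product]; exact Finset.card_filter_le _ _

/-! ## The six-fold fixed-point count as a cyclic triple sum -/

/-- For a single pair set: `Σ_{(x,y) ∈ X×Y} [x⁻¹y w = p] = m_{XY}(p,w)`. [folklore] -/
theorem sum_ite_quot_apply (X Y : Finset (Equiv.Perm (Fin n))) (p w : Fin n) :
    ∑ xy ∈ X ×ˢ Y, (if (xy.1⁻¹ * xy.2) w = p then (1 : ℕ) else 0) =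
      ((X ×ˢ Y).filter fun xy => xy.2 w = xy.1 p).card := by
  classical
  rw [Finset.card_filter]
  refine Finset.sum_congr rfl fun xy _ => ?_
  simp only [Equiv.Perm.mul_apply, Equiv.Perm.inv_eq_iff_eq]

/-- **`T₃ = Σ_{p,q,w} m_{ST}(p,w)·m_{TU}(w,q)·m_{US}(q,p)`**: the six-fold fixed-point count of the
words `s⁻¹t·t'⁻¹u·u'⁻¹s'` over `(S×T)×(T×U)×(U×S)` is the cyclic triple sum of the pair marginals.
[folklore] -/
theorem sixFoldFix_eq_tripleSum (S T U : Finset (Equiv.Perm (Fin n))) :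
    ∑ y ∈ ((S ×ˢ T) ×ˢ (T ×ˢ U)) ×ˢ (U ×ˢ S),
        (Finset.univ.filter fun p : Fin n =>
          (y.1.1.1⁻¹ * y.1.1.2 * (y.1.2.1⁻¹ * y.1.2.2) * (y.2.1⁻¹ * y.2.2)) p = p).card =
      ∑ p : Fin n, ∑ q : Fin n, ∑ w : Fin n,
        ((S ×ˢ T).filter fun st => st.2 w = st.1 p).card *
          (((T ×ˢ U).filter fun tu => tu.2 q = tu.1 w).card *
            ((U ×ˢ S).filter fun us => us.2 p = us.1 q).card) := by
  classical
  -- `#fix(g) = Σ_p [g p = p]`, then exchange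
  simp_rw [Finset.card_filter]
  rw [Finset.sum_comm]
  refine Finset.sum_congr rfl fun p _ => ?_
  -- for fixed `p`: insert the intermediate points `q = c p`, `w = b q`
  have key : ∀ y : ((Equiv.Perm (Fin n) × Equiv.Perm (Fin n)) ×
      (Equiv.Perm (Fin n) × Equiv.Perm (Fin n))) × (Equiv.Perm (Fin n) × Equiv.Perm (Fin n)),
      (if (y.1.1.1⁻¹ * y.1.1.2 * (y.1.2.1⁻¹ * y.1.2.2) * (y.2.1⁻¹ * y.2.2)) p = p then (1 : ℕ) else 0) =
        ∑ q : Fin n, ∑ w : Fin n,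
          (if (y.1.1.1⁻¹ * y.1.1.2) w = p then (1 : ℕ) else 0) *
            ((if (y.1.2.1⁻¹ * y.1.2.2) q = w then (1 : ℕ) else 0) *
              (if (y.2.1⁻¹ * y.2.2) p = q then (1 : ℕ) else 0)) := by
    intro y
    -- only `q = c p` and then only `w = b q` contribute
    rw [Finset.sum_eq_single ((y.2.1⁻¹ * y.2.2) p)
      (fun q _ hq => Finset.sum_eq_zero fun w _ => by rw [if_neg (Ne.symm hq), mul_zero, mul_zero])
      (fun h => absurd (Finset.mem_univ _) h)]
    rw [Finset.sum_eq_single ((y.1.2.1⁻¹ * y.1.2.2) ((y.2.1⁻¹ * y.2.2) p))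
      (fun w _ hw => by rw [if_neg (Ne.symm hw), zero_mul, mul_zero])
      (fun h => absurd (Finset.mem_univ _) h)]
    rw [if_pos rfl, if_pos rfl, mul_one, mul_one]
    simp only [Equiv.Perm.mul_apply]
    congr 1
  simp_rw [key]
  -- exchange `Σ_y` with `Σ_{q,w}`
  rw [Finset.sum_comm]
  refine Finset.sum_congr rfl fun q _ => ?_
  rw [Finset.sum_comm]
  refine Finset.sum_congr rfl fun w _ => ?_
  -- the summand factors over the three pair sets
  rw [Finset.sum_product, Finset.sum_product]
  simp only [Equiv.Perm.mul_apply, Equiv.Perm.inv_eq_iff_eq]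
  rw [Finset.sum_mul_sum, Finset.sum_mul_sum]
  refine Finset.sum_congr rfl fun st _ => Finset.sum_congr rfl fun tu _ => ?_
  rw [Finset.mul_sum]

/-! ## Pair marginals as marginals of the quotient set -/

/-- If `(x,y) ↦ x⁻¹y` is injective on `X × Y` then `|X⁻¹Y| = |X||Y|`. [folklore] -/
theorem card_image₂_of_injOn' {X Y : Finset (Equiv.Perm (Fin n))}
    (hinj : Set.InjOn (fun xy : Equiv.Perm (Fin n) × Equiv.Perm (Fin n) => xy.1⁻¹ * xy.2)
      (↑X ×ˢ ↑Y : Set (Equiv.Perm (Fin n) × Equiv.Perm (Fin n)))) :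
    (Finset.image₂ (fun x y : Equiv.Perm (Fin n) => x⁻¹ * y) X Y).card = X.card * Y.card :=
  (Finset.card_image₂_iff (f := fun x y : Equiv.Perm (Fin n) => x⁻¹ * y)).2 hinj

/-- If `(x,y) ↦ x⁻¹y` is injective on `X × Y` then the pair marginal of `(X, Y)` is the marginal of
the quotient set `A = X⁻¹Y`: `#{(x,y) : y j = x i} = #{a ∈ A : a j = i}`. [folklore] -/
theorem pairMarginal_eq_marginal_image₂ {X Y : Finset (Equiv.Perm (Fin n))}
    (hinj : Set.InjOn (fun xy : Equiv.Perm (Fin n) × Equiv.Perm (Fin n) => xy.1⁻¹ * xy.2)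
      (↑X ×ˢ ↑Y : Set (Equiv.Perm (Fin n) × Equiv.Perm (Fin n)))) (i j : Fin n) :
    ((X ×ˢ Y).filter fun xy => xy.2 j = xy.1 i).card =
      ((Finset.image₂ (fun x y : Equiv.Perm (Fin n) => x⁻¹ * y) X Y).filter fun a => a j = i).card := by
  classical
  rw [← Finset.image_uncurry_product, Finset.filter_image, Finset.card_image_of_injOn]
  · congr 1
    ext ⟨x, y⟩
    simp only [Finset.mem_filter, Function.uncurry_apply_pair, Equiv.Perm.mul_apply,
      Equiv.Perm.inv_eq_iff_eq]
  · intro a ha b hb hab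
    have ha' : a ∈ X ×ˢ Y := (Finset.mem_filter.1 (Finset.mem_coe.1 ha)).1
    have hb' : b ∈ X ×ˢ Y := (Finset.mem_filter.1 (Finset.mem_coe.1 hb)).1
    exact hinj (by simpa using ha') (by simpa using hb') hab

/-- **Excess cap for pair marginals**: if `(x,y) ↦ x⁻¹y` is injective on `X × Y` (`n ≥ 40`) then
`(n-1)·Σ_{i,j} m_{XY}(i,j)² ≤ |X||Y|·(n! + (n-2)|X||Y|)`. [folklore] -/
theorem excess_cap_pair (hn : 40 ≤ n) {X Y : Finset (Equiv.Perm (Fin n))}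
    (hinj : Set.InjOn (fun xy : Equiv.Perm (Fin n) × Equiv.Perm (Fin n) => xy.1⁻¹ * xy.2)
      (↑X ×ˢ ↑Y : Set (Equiv.Perm (Fin n) × Equiv.Perm (Fin n)))) :
    ((n : ℝ) - 1) * ∑ i : Fin n, ∑ j : Fin n, (((X ×ˢ Y).filter fun xy => xy.2 j = xy.1 i).card : ℝ) ^ 2 ≤
      ((X.card * Y.card : ℕ) : ℝ) * ((n.factorial : ℝ) + ((n : ℝ) - 2) * (X.card * Y.card : ℕ)) := by
  have h := excess_cap n hn (Finset.image₂ (fun x y : Equiv.Perm (Fin n) => x⁻¹ * y) X Y)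
  rw [card_image₂_of_injOn' hinj] at h
  simp_rw [← pairMarginal_eq_marginal_image₂ hinj] at h
  exact h

end Summit.MatrixMultiplication.MatrixMultiplication.Theorems.PolynomialSlack
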